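import Summits.ABC.IUTFork.Thm311RealInd1StripPacketDualBoxVolume
import Literature.IUT.LogVolume.GenuineLogThetaPerImageSubIndeterminacy
import Literature.IUT.LogVolume.GenuineLogThetaPerImageTameContent
import Literature.IUT.LogVolume.CompletionLocalFields
import HarnessLib

/-!
# [IUTchIII] Thm 3.11 (i) (Ind1)+(Ind2) ⟶ Cor 3.12 Step (x), reading (P): the `ln ν̄_{𝕃_p}`-level FAILURE side — ONE collection of the place
# section failing its room inequality makes the (P)-reading over any print-dominated sub-indeterminacy `H` drop STRICTLY below the
# Dupuy–Hilado container's `−|log(Θ)|^{(P)}_p`, by at least `Pr(v⃗)·(Σ_j f(L_j)/D)·(log p)/ℓ⋆` (UNCONDITIONAL)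

PROOF-ONLY file (abc-iut cell, Cor. 3.12 sub-crew, seat abc-iut-c312-1 = holder of record of the typed [IUTchIII] Thm. 3.11, gen 21; offer (π′)
«C:VOLUME-FORM CONVERSE», file 3 — the `ln ν̄_{𝕃_p}` port of file 2 `Thm311RealInd1StripPacketDualBoxVolume`).  TAKES NO SIDE on [IUTchIII]
Cor. 3.12.  No definition, no `Prop` fact, NO `JannsenWingbergMappingClass`: everything UNCONDITIONAL.

SETTING.  The real prime packet `Q = realPrimePacketWith p (σ.localFields p) c` over the GENUINE completions `K_{v̲}` of a place section
`σ : V(F₀) → V(K)` (any shell normalisation `c`; abc-iut-c312-3 / abc-iut-c312-d1), a `p`-local Θ-idele `t`, and a family `H = (H_{j,v⃗})` of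
subgroups of the packet automorphisms with `H_{j,v⃗} ≤ indTwo = Aut_{ℚ_p}(X_{v⃗} : log_p(R_I^×))` (the Dupuy–Hilado container).  "Reading (P) over
`H`" is `ln ν̄_{𝕃_p}(v⃗ ↦ hull(⋃_{g ∈ H_{v⃗}} g(O_𝕃(−P_Θ)_{v⃗})))` (written INLINE, as in abc-iut-c312-d1's `GenuineLogThetaPerImageSubIndeterminacy`);
it is ALWAYS `≤ −|log(Θ)|^{(P)}_p` (`realPrimePacketWith_lnνLp_hull_orbitH_le_negLogThetaPerImageAt`, abc-iut-c312-d1, BY NAME).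

* §1 `lnνLp_le_sub_of_succ` — quantitative monotonicity of `ln ν̄_{𝕃_p}` on ANY prime packet: summandwise `A ⊆ B` (admissible) and, at ONE
  degree `j₁ = i₁+1 ≤ ℓ⋆` and ONE collection `v⃗₁`, `log μ̄(A_{v⃗₁}) ≤ log μ̄(B_{v⃗₁}) − m` ⟹ `ln ν̄_{𝕃_p}(A) ≤ ln ν̄_{𝕃_p}(B) − (1/ℓ⋆)·m·Π_b Pr(v_{1,b})`
  (Dupuy–Hilado Def. 3.6.3 bookkeeping: `ln ν̄_{𝕃_p} = (1/ℓ⋆)·Σ_j Σ_{v⃗} log μ̄_{v⃗}(·)·Π_b Pr(v_b)`).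
* §2 **`localFields_lnνLp_hull_orbitH_le_negLogThetaPerImageAt_sub_of_not_room_mixed`** — if at ONE degree `j₁ = i₁+1 ≤ ℓ⋆` and ONE collection
  `v⃗₁ = e₁` of the section every factor `K_{v̲_{1,b}}` is TAME, `‖t_{i₁,v_{1,j₁}}‖ = p^{−v/E}`, the bits are available only on `S` (off `S`: residue
  degree one, `e_b ≥ 2`, `hfix`), the room inequality `((v−1) % E + 1)/E + Σ_{b∉S} 1/e_b ≤ 1` FAILS, and `H_{j₁,v⃗₁}` acts factorwise through the
  realised strip groups, then **`ln ν̄_{𝕃_p}(reading over H) ≤ −|log(Θ)|^{(P)}_p − (1/ℓ⋆)·(Σ_j f(L_j)/D)·log p·Π_b Pr(v_{1,b})`** — file 2 §1 at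
  `v⃗₁` (the hull of the `H`-orbit has `log μ̄` at least `(Σ_j f_j/D)·log p` below `log μ̄(packetHull(p^{A}·log_p(R_I^×)))`), the UNCONDITIONAL tame
  content identity `slotImagesHull(O_𝕃(−P_Θ)_{v⃗₁}) = packetHull(p^{A}·log_p(R_I^×))` (abc-iut-c312-1 R22 `realPrimePacketWith_slotImagesHull_pilotRegion_eq_of_tame`,
  p540946), and abc-iut-c312-d1's summandwise `orbit ⊆ slot images` / admissibility at every other collection, assembled by §1;
  **`…_lt_negLogThetaPerImageAt_of_not_room_mixed`**: hence `<` (every `Pr(v) > 0`).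
READING (numbers about OUR typed objects; neutral): R21/R22 (p539517, p541705) say that at a prime over which EVERY collection satisfies the
junction identity the (P)-reading over print's (Ind1)⊔(Ind2) AS TYPED IS `−|log(Θ)|^{(P)}_p` (mod hMC); this file is the other branch with a
NUMBER: ONE failing-room collection of positive weight (bits only on `S`) forces the (P)-reading over any factorwise-strip `H ≤ indTwo` — e.g. the
subgroup generated by print's single-factor (Ind1) strip moves (R28 (λ3) non-vacuity) — STRICTLY below the container's per-image number, by the
displayed margin; so, by abc-iut-c312-d1's monotonicity, [IUTchIII] Cor. 3.12 in reading (P) over such an `H` is STRICTLY HARDER there than over the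
container.  Which value a bit takes at a given place is NOT claimed; whether a given Θ-idele has a failing-room collection is arithmetic of
`(ord t, e_b, f_b, bits)` and is NOT decided here.  HONEST SCOPE: unconditional; OUR typings (THE equivariant lift, THE logarithm, factorwise action;
F-B28-1 untouched); EVEN degree (identity side), WILD, `p = 2` outside; equal-AS-TYPED ≠ equal in print; nothing here asserts that abc is proved or
refuted; no side taken on [IUTchIII] Cor. 3.12 / [IUTchIV] Thm. 1.10, on (U) vs (P), or on any author.
[claim: Mochizuki2012, status: disputed]; [cite: Mochizuki2012, IUTchIII Thm. 3.11 (i) p. 154; Rmk. 3.9.5 (i) p. 127; Cor. 3.12 Step (x) p. 181, Step (xi)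
p. 183; IUTchIV Prop. 1.1 p. 9, Prop. 1.2 (ii) pp. 10–11, Prop. 1.4 (i), (iii) pp. 13–14]; [cite: DupuyHilado2025, §3.6, Def. 3.6.3, §3.9, §4.9, §4.12].
typed ≠ proved.
-/

set_option autoImplicit false

noncomputable section

open Metric Set Function Module
open scoped Pointwise TensorProduct

namespace Summit.ABC.IUTFork.Thm311.Real

open NumberField IsDedekindDomain Literature.NumberTheory.NumberFields Literature.IUT.LogVolume
open Literature.NumberTheory.GaloisRepresentations Literature.NumberTheory.GaloisRepresentations.Ultrametric
open Literature.AnabelianGeometry.AbsoluteAnabelian Literature.IUT.HodgeArakelov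
open Literature.IUT.HodgeArakelov.AbsTopMonoids

/-! ## §1 Quantitative monotonicity of `ln ν̄_{𝕃_p}` (any prime packet) -/

section AnyPacket

variable {F : Type} [Field F] [NumberField F] {p : ℕ} (Q : PrimePacket F p)

/-- A finite sum with termwise `≤` and one term `≤ · − m` is `≤` the other sum `− m`. [folklore] -/
private theorem sum_le_sum_sub_of_le {ι : Type} [Fintype ι] {f g : ι → ℝ} (hle : ∀ x, f x ≤ g x) (a : ι) {m : ℝ}
    (ha : f a ≤ g a - m) : ∑ x, f x ≤ ∑ x, g x - m := by
  classical
  rw [← Finset.add_sum_erase _ f (Finset.mem_univ a), ← Finset.add_sum_erase _ g (Finset.mem_univ a)]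
  have h := Finset.sum_le_sum (s := Finset.univ.erase a) fun x _ => hle x
  linarith

/-- **Quantitative monotonicity of `ln ν̄_{𝕃_p}`** (Dupuy–Hilado Def. 3.6.3: `ln ν̄_{𝕃_p}(B) = (1/ℓ⋆)·Σ_{j=1}^{ℓ⋆} Σ_{v⃗} log μ̄_{v⃗}(B_{v⃗})·Π_b Pr(v_b)`):
if in every degree `j = i+1 ≤ ℓ⋆` and collection both regions are admissible with `A ⊆ B`, and at ONE `(i₁, v⃗₁)` moreover
`log μ̄(A_{v⃗₁}) ≤ log μ̄(B_{v⃗₁}) − m`, then `ln ν̄_{𝕃_p}(A) ≤ ln ν̄_{𝕃_p}(B) − (1/ℓ⋆)·m·Π_b Pr(v_{1,b})`. [cite: DupuyHilado2025, §3.6, Def. 3.6.3] -/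
theorem lnνLp_le_sub_of_succ (lstar : ℕ) {A B : Q.Region}
    (h : ∀ (i : Fin lstar) (e : Fin ((i : ℕ) + 1 + 1) → placesOver F p),
      Q.adm (A ((i : ℕ) + 1) e) ∧ Q.adm (B ((i : ℕ) + 1) e) ∧ A ((i : ℕ) + 1) e ⊆ B ((i : ℕ) + 1) e)
    (i₁ : Fin lstar) (e₁ : Fin ((i₁ : ℕ) + 1 + 1) → placesOver F p) {m : ℝ}
    (hm : Q.logμ (A ((i₁ : ℕ) + 1) e₁) ≤ Q.logμ (B ((i₁ : ℕ) + 1) e₁) - m) :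
    Q.lnνLp lstar A ≤ Q.lnνLp lstar B - (1 / (lstar : ℝ)) * (m * ∏ b, weight F (e₁ b).1) := by
  unfold PrimePacket.lnνLp PrimePacket.lnνTensorPower
  rw [← mul_sub]
  refine mul_le_mul_of_nonneg_left ?_ (by positivity)
  have hw : ∀ {j : ℕ} (e : Fin (j + 1) → placesOver F p), 0 ≤ ∏ b, weight F (e b).1 :=
    fun e => Finset.prod_nonneg fun b _ => weight_nonneg F _
  -- termwise `≤` in every degree and collection
  have hle : ∀ (i : Fin lstar) (e : Fin ((i : ℕ) + 1 + 1) → placesOver F p),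
      Q.logμ (A ((i : ℕ) + 1) e) * ∏ b, weight F (e b).1 ≤ Q.logμ (B ((i : ℕ) + 1) e) * ∏ b, weight F (e b).1 := by
    intro i e
    obtain ⟨hA, hB, hAB⟩ := h i e
    exact mul_le_mul_of_nonneg_right (Q.logμ_mono hA hB hAB) (hw e)
  -- the special term
  have h₁ : Q.logμ (A ((i₁ : ℕ) + 1) e₁) * ∏ b, weight F (e₁ b).1 ≤
      Q.logμ (B ((i₁ : ℕ) + 1) e₁) * ∏ b, weight F (e₁ b).1 - m * ∏ b, weight F (e₁ b).1 := by
    rw [← sub_mul]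
    exact mul_le_mul_of_nonneg_right hm (hw e₁)
  refine sum_le_sum_sub_of_le (fun i => Finset.sum_le_sum fun e _ => hle i e) i₁ ?_
  exact sum_le_sum_sub_of_le (fun e => hle i₁ e) e₁ h₁

end AnyPacket

/-! ## §2 The genuine place-section packets: one failing-room collection ⟹ strict drop below `−|log(Θ)|^{(P)}_p` -/

section PlaceSection

variable {F₀ : Type} [Field F₀] [NumberField F₀] {K : Type} [Field K] [NumberField K] [Algebra F₀ K]
variable (σ : PlaceSection F₀ K) (p : ℕ) [hp : Fact p.Prime]
variable (c : (j : ℕ) → (Fin (j + 1) → placesOver F₀ p) → ℚ_[p]) (hc0 : ∀ j e, c j e ≠ 0)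
  (hcσ : ∀ (j : ℕ) (τ : Equiv.Perm (Fin (j + 1))) (e : Fin (j + 1) → placesOver F₀ p), c j (e ∘ τ) = c j e)

/-- **ONE FAILING-ROOM COLLECTION ⟹ THE (P)-READING OVER `H` DROPS BELOW `−|log(Θ)|^{(P)}_p` BY AN EXPLICIT MARGIN (UNCONDITIONAL).**  Real prime packet
over the genuine completions of a place section (any shell `c`), Θ-idele `t`, family `H = (H_{j,v⃗})` of subgroups of the container `indTwo`.  If at
ONE degree `j₁ = i₁+1 ≤ ℓ⋆` and ONE collection `v⃗₁ = e₁` every factor is TAME (`e_b ≤ p − 2`), `‖t_{i₁,v_{1,j₁}}‖ = p^{−v/E}`, bits are available only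
on `S` (off `S`: residue degree one, `e_b ≥ 2`, no realised strip automorphism moves `ℤ_p·p` modulo `p·log_p(𝒪^×)`), the room inequality FAILS, and
`H_{j₁,v⃗₁}` acts factorwise through the realised strip groups, then
`ln ν̄_{𝕃_p}(v⃗ ↦ hull(⋃_{g∈H_{v⃗}} g(O_𝕃(−P_Θ)_{v⃗}))) ≤ −|log(Θ)|^{(P)}_p − (1/ℓ⋆)·((Σ_j f(L_j)/D)·log p)·Π_b Pr(v_{1,b})` (file 2 §1 + R22's tame
content identity + abc-iut-c312-d1's summandwise monotonicity, by §1). [claim: Mochizuki2012, status: disputed]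
[cite: Mochizuki2012, IUTchIII Thm. 3.11 (i) p. 154; Cor. 3.12 proof Step (x) p. 181; IUTchIV Prop. 1.4 (iii) p. 13] [cite: DupuyHilado2025, Def. 3.6.3, §3.9, §4.9, §4.12] -/
theorem localFields_lnνLp_hull_orbitH_le_negLogThetaPerImageAt_sub_of_not_room_mixed (hp2 : 2 < p) {lstar : ℕ}
    (t : Fin lstar → (v : placesOver F₀ p) → ((σ.localFields p).k v)ˣ)
    (H : (j : ℕ) → (e : Fin (j + 1) → placesOver F₀ p) →
      Subgroup (PacketAlgebra p (fun b => (σ.localFields p).k (e b)) ≃ₗ[ℚ_[p]]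
        PacketAlgebra p (fun b => (σ.localFields p).k (e b))))
    (hH : ∀ j e, H j e ≤ indTwo p (fun b => (σ.localFields p).k (e b)))
    (i₁ : Fin lstar) (e₁ : Fin ((i₁ : ℕ) + 1 + 1) → placesOver F₀ p)
    (he : ∀ b, absRamificationIdx p ((σ.localFields p).k (e₁ b)) ≤ p - 2)
    {v : ℤ} (hv : ‖(t i₁ (e₁ (Fin.last _)) : (σ.localFields p).k (e₁ (Fin.last _)))‖ =
      (p : ℝ) ^ (-(v / (absRamificationIdx p ((σ.localFields p).k (e₁ (Fin.last _))) : ℝ))))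
    (S : Finset (Fin ((i₁ : ℕ) + 1 + 1)))
    (he2 : ∀ b, b ∉ S → 2 ≤ absRamificationIdx p ((σ.localFields p).k (e₁ b)))
    (hf : ∀ b, b ∉ S → (σ.lift (e₁ b).1).asIdeal.inertiaDeg ℤ = 1)
    (hfix : ∀ b, b ∉ S → ∀ ψ ∈ ind1StripOf (σ.lift (e₁ b).1) (galoisLog (σ.lift (e₁ b).1)),
      RescaledCompletion.of K p (σ.lift (e₁ b).1) (σ.natCast_mem_lift (e₁ b)) (ψ (p : (σ.lift (e₁ b).1).adicCompletion K)) -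
          (p : RescaledCompletion K p (σ.lift (e₁ b).1) (σ.natCast_mem_lift (e₁ b))) ∈
        (p : ℚ_[p]) • logUnits (RescaledCompletion K p (σ.lift (e₁ b).1) (σ.natCast_mem_lift (e₁ b))))
    (hnotroom : ¬ ((((v - 1) % (absRamificationIdx p ((σ.localFields p).k (e₁ (Fin.last _))) : ℤ) + 1 : ℤ) : ℝ) /
        (absRamificationIdx p ((σ.localFields p).k (e₁ (Fin.last _))) : ℝ) +
      ∑ b ∈ Finset.univ \ S, (1 : ℝ) / (absRamificationIdx p ((σ.localFields p).k (e₁ b)) : ℝ) ≤ 1))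
    (hHfac : ∀ γ ∈ H ((i₁ : ℕ) + 1) e₁, ∃ δ : Π b, AddAut ((σ.lift (e₁ b).1).adicCompletion K),
      (∀ b, δ b ∈ AddSubgroup.closure (G := AddAut ((σ.lift (e₁ b).1).adicCompletion K))
        (ind1StripOf (σ.lift (e₁ b).1) (galoisLog (σ.lift (e₁ b).1)))) ∧
      ∀ z : Π b, (σ.localFields p).k (e₁ b),
        (γ : PacketAlgebra p (fun b => (σ.localFields p).k (e₁ b)) ≃ₗ[ℚ_[p]]
            PacketAlgebra p (fun b => (σ.localFields p).k (e₁ b))) (PiTensorProduct.tprod ℚ_[p] z) =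
          PiTensorProduct.tprod ℚ_[p] (fun b => RescaledCompletion.of K p (σ.lift (e₁ b).1) (σ.natCast_mem_lift (e₁ b))
            (δ b ((RescaledCompletion.of K p (σ.lift (e₁ b).1) (σ.natCast_mem_lift (e₁ b))).symm (z b))))) :
    (realPrimePacketWith p (σ.localFields p) c hc0 hcσ).lnνLp lstar (fun j e =>
        packetHull p (fun b => (σ.localFields p).k (e b))
          (⋃ g : H j e, (g : PacketAlgebra p (fun b => (σ.localFields p).k (e b)) ≃ₗ[ℚ_[p]]
              PacketAlgebra p (fun b => (σ.localFields p).k (e b))) ''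
            (realPrimePacketWith p (σ.localFields p) c hc0 hcσ).pilotRegion t j e)) ≤
      (realPrimePacketWith p (σ.localFields p) c hc0 hcσ).negLogThetaPerImageAt lstar t -
        (1 / (lstar : ℝ)) *
          (((∑ j, (residueDegree p (DFac p (fun b => (σ.localFields p).k (e₁ b)) j) : ℝ)) /
              packetDegree p (DFac p (fun b => (σ.localFields p).k (e₁ b))) * Real.log p) *
            ∏ b, weight F₀ (e₁ b).1) := by
  unfold PrimePacket.negLogThetaPerImageAt
  refine lnνLp_le_sub_of_succ (realPrimePacketWith p (σ.localFields p) c hc0 hcσ) lstar (fun i e => ⟨?_, ?_, ?_⟩) i₁ e₁ ?_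
  · exact realPrimePacketWith_packetAdm_hull_orbitH p (σ.localFields p) c hc0 hcσ t i e (H _ e) (hH _ e)
  · obtain ⟨m, -, -, -, hadm, -⟩ := realPrimePacketWith_exists_content_logμ_slotImagesHull p (σ.localFields p) c hc0 hcσ t i e
    exact hadm
  · exact packetHull_mono p _ (realPrimePacketWith_orbitH_subset_slotImages p (σ.localFields p) c hc0 hcσ t i e (H _ e) (hH _ e))
  · -- the special summand: file 2 §1 at `v⃗₁`, read against the tame content identity for the container's summand
    show packetLogμ p (fun b => (σ.localFields p).k (e₁ b)) _ ≤
      packetLogμ p (fun b => (σ.localFields p).k (e₁ b))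
        ((realPrimePacketWith p (σ.localFields p) c hc0 hcσ).slotImagesHull
          ((realPrimePacketWith p (σ.localFields p) c hc0 hcσ).pilotRegion t) ((i₁ : ℕ) + 1) e₁) - _
    rw [realPrimePacketWith_slotImagesHull_pilotRegion_eq_of_tame p (σ.localFields p) c hc0 hcσ hp2 t i₁ e₁ he hv,
      realPrimePacketWith_pilotRegion_succ_eq]
    obtain ⟨-, hle, -⟩ := packetLogμ_packetHull_orbit_le_container_sub_of_not_room_mixed p (fun b => σ.lift (e₁ b).1)
      (fun b => σ.natCast_mem_lift (e₁ b)) hp2 he (Fin.last _) hv S he2 hf hfix hnotroom (H _ e₁) hHfac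
    exact hle

/-- **Hence STRICTLY below `−|log(Θ)|^{(P)}_p`** (every `Pr(v) = n_v/[F₀:ℚ] > 0`, `ℓ⋆ ≥ 1`, the margin `(Σ_j f_j/D)·log p > 0`): under the hypotheses of
`…_le_negLogThetaPerImageAt_sub_of_not_room_mixed`, `ln ν̄_{𝕃_p}(reading (P) over H) < −|log(Θ)|^{(P)}_p`.  With abc-iut-c312-d1's
`realPrimePacketWith_lnνLp_hull_orbitH_le_negLogThetaPerImageAt` (always `≤`): [IUTchIII] Cor. 3.12 in reading (P) over such an `H` is strictly harder
than over the container at this prime. [claim: Mochizuki2012, status: disputed]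
[cite: Mochizuki2012, IUTchIII Thm. 3.11 (i) p. 154; Cor. 3.12 proof Step (x) p. 181] [cite: DupuyHilado2025, Def. 3.6.3, §4.9, §4.12] -/
theorem localFields_lnνLp_hull_orbitH_lt_negLogThetaPerImageAt_of_not_room_mixed (hp2 : 2 < p) {lstar : ℕ}
    (t : Fin lstar → (v : placesOver F₀ p) → ((σ.localFields p).k v)ˣ)
    (H : (j : ℕ) → (e : Fin (j + 1) → placesOver F₀ p) →
      Subgroup (PacketAlgebra p (fun b => (σ.localFields p).k (e b)) ≃ₗ[ℚ_[p]]
        PacketAlgebra p (fun b => (σ.localFields p).k (e b))))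
    (hH : ∀ j e, H j e ≤ indTwo p (fun b => (σ.localFields p).k (e b)))
    (i₁ : Fin lstar) (e₁ : Fin ((i₁ : ℕ) + 1 + 1) → placesOver F₀ p)
    (he : ∀ b, absRamificationIdx p ((σ.localFields p).k (e₁ b)) ≤ p - 2)
    {v : ℤ} (hv : ‖(t i₁ (e₁ (Fin.last _)) : (σ.localFields p).k (e₁ (Fin.last _)))‖ =
      (p : ℝ) ^ (-(v / (absRamificationIdx p ((σ.localFields p).k (e₁ (Fin.last _))) : ℝ))))
    (S : Finset (Fin ((i₁ : ℕ) + 1 + 1)))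
    (he2 : ∀ b, b ∉ S → 2 ≤ absRamificationIdx p ((σ.localFields p).k (e₁ b)))
    (hf : ∀ b, b ∉ S → (σ.lift (e₁ b).1).asIdeal.inertiaDeg ℤ = 1)
    (hfix : ∀ b, b ∉ S → ∀ ψ ∈ ind1StripOf (σ.lift (e₁ b).1) (galoisLog (σ.lift (e₁ b).1)),
      RescaledCompletion.of K p (σ.lift (e₁ b).1) (σ.natCast_mem_lift (e₁ b)) (ψ (p : (σ.lift (e₁ b).1).adicCompletion K)) -
          (p : RescaledCompletion K p (σ.lift (e₁ b).1) (σ.natCast_mem_lift (e₁ b))) ∈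
        (p : ℚ_[p]) • logUnits (RescaledCompletion K p (σ.lift (e₁ b).1) (σ.natCast_mem_lift (e₁ b))))
    (hnotroom : ¬ ((((v - 1) % (absRamificationIdx p ((σ.localFields p).k (e₁ (Fin.last _))) : ℤ) + 1 : ℤ) : ℝ) /
        (absRamificationIdx p ((σ.localFields p).k (e₁ (Fin.last _))) : ℝ) +
      ∑ b ∈ Finset.univ \ S, (1 : ℝ) / (absRamificationIdx p ((σ.localFields p).k (e₁ b)) : ℝ) ≤ 1))
    (hHfac : ∀ γ ∈ H ((i₁ : ℕ) + 1) e₁, ∃ δ : Π b, AddAut ((σ.lift (e₁ b).1).adicCompletion K),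
      (∀ b, δ b ∈ AddSubgroup.closure (G := AddAut ((σ.lift (e₁ b).1).adicCompletion K))
        (ind1StripOf (σ.lift (e₁ b).1) (galoisLog (σ.lift (e₁ b).1)))) ∧
      ∀ z : Π b, (σ.localFields p).k (e₁ b),
        (γ : PacketAlgebra p (fun b => (σ.localFields p).k (e₁ b)) ≃ₗ[ℚ_[p]]
            PacketAlgebra p (fun b => (σ.localFields p).k (e₁ b))) (PiTensorProduct.tprod ℚ_[p] z) =
          PiTensorProduct.tprod ℚ_[p] (fun b => RescaledCompletion.of K p (σ.lift (e₁ b).1) (σ.natCast_mem_lift (e₁ b))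
            (δ b ((RescaledCompletion.of K p (σ.lift (e₁ b).1) (σ.natCast_mem_lift (e₁ b))).symm (z b))))) :
    (realPrimePacketWith p (σ.localFields p) c hc0 hcσ).lnνLp lstar (fun j e =>
        packetHull p (fun b => (σ.localFields p).k (e b))
          (⋃ g : H j e, (g : PacketAlgebra p (fun b => (σ.localFields p).k (e b)) ≃ₗ[ℚ_[p]]
              PacketAlgebra p (fun b => (σ.localFields p).k (e b))) ''
            (realPrimePacketWith p (σ.localFields p) c hc0 hcσ).pilotRegion t j e)) <
      (realPrimePacketWith p (σ.localFields p) c hc0 hcσ).negLogThetaPerImageAt lstar t := by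
  have hle := localFields_lnνLp_hull_orbitH_le_negLogThetaPerImageAt_sub_of_not_room_mixed σ p c hc0 hcσ hp2 t H hH i₁ e₁ he hv S
    he2 hf hfix hnotroom hHfac
  haveI : Nonempty (Fin ((i₁ : ℕ) + 1 + 1)) := ⟨Fin.last _⟩
  have hmar := margin_pos p (fun b => (σ.localFields p).k (e₁ b))
  have hl : (0 : ℝ) < 1 / (lstar : ℝ) := by
    have : 0 < lstar := lt_of_le_of_lt (Nat.zero_le _) i₁.2
    positivity
  have hw : 0 < ∏ b, weight F₀ (e₁ b).1 := by
    refine Finset.prod_pos fun b _ => ?_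
    unfold weight
    have h1 : (0 : ℝ) < localDegree F₀ (e₁ b).1 := by exact_mod_cast localDegree_pos F₀ (e₁ b).1
    have h2 : (0 : ℝ) < Module.finrank ℚ F₀ := by exact_mod_cast Module.finrank_pos
    exact div_pos h1 h2
  have hpos : 0 < (1 / (lstar : ℝ)) *
      (((∑ j, (residueDegree p (DFac p (fun b => (σ.localFields p).k (e₁ b)) j) : ℝ)) /
          packetDegree p (DFac p (fun b => (σ.localFields p).k (e₁ b))) * Real.log p) *
        ∏ b, weight F₀ (e₁ b).1) := mul_pos hl (mul_pos hmar hw)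
  linarith

end PlaceSection

end Summit.ABC.IUTFork.Thm311.Real

end
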